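import Literature.Computability.AlgebraicComplexity.ArithCircuitDegreeBound
import Literature.Computability.AlgebraicComplexity.ArithCircuitProjections
import Summits.ValiantsHypothesis.ValiantsHypothesis.Theorems.SuccinctLiftNumberFieldDescent

/-!
# SuccinctLift — generic algebraic advice is free at the identical skeleton (graded autarky)

Route `route-ValiantsHypothesis-SuccinctLift` (lens 2), wall D (`AlgDescentLog3`,
stmt-ValiantsHypothesis-23721).  Gen 29 showed that constants generating a number field of
POLYNOMIAL degree are free (`perEasyNF_iff_perEasyRat`), leaving as open core (b) of wall D the
constants of SUPER-polynomial degree.  This file removes the GENERIC part of (b), from the other end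
of the dial:

* `IsGenericAt F α δ` — the advice tuple `α : τ → L` satisfies no polynomial relation over `F` of
  total degree `≤ δ` ("generic at scale `δ`"; `δ = ∞` is algebraic independence,
  `isGenericAt_of_algebraicIndependent`).
* `eval_eq_rename_of_isGenericAt` — if a circuit skeleton `C₀` over `F` with advice variables `τ`,
  run over `L` with advice `α` generic at a scale `δ ≥ deg C₀.eval`, computes a polynomial
  `f ∈ F[σ]`, then the skeleton ignores its advice: `C₀.eval = rename inl f`.  Hence ANY advice —
  in particular `F`-rational advice — computes `f` with the IDENTICAL skeleton (same gates, wires,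
  product-depth): `computes_substVC_of_isGenericAt`, `computes_advice_of_isGenericAt`; the scale
  `s^Δ` (wires `s`, product-depth `Δ`) always suffices (`computes_substVC_of_isGenericAt_pow`).
* `perEasyGeneric_iff_perEasyRat` — dial corollary for the permanent at every depth profile `Δ`:
  poly-wire depth-`Δ` circuits over `ℂ` whose non-rational constants are generic at scale
  `(n^c+c)^{Δ(n)}` exist iff poly-wire depth-`Δ` circuits over `ℚ` exist.

This is a GRADED form of autarky (Bürgisser–Clausen–Shokrollahi (4.15)–(4.18): purely
transcendental extensions are autarkical; here an ALGEBRAIC extension `F(α)` is autarkical for all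
division-free circuits of formal degree below the genericity scale of `α`, with no loss in the
skeleton).  Reading for wall D (honest): after gen 28 (`𝔽₂`-points excluded) and gen 29 (polynomial
degree free) the open core of `AlgDescentLog3` is carried by constant tuples that are algebraically
DEPENDENT at scale `s^{Δ₁} = (n^c+c)^{⌊log₃ n⌋+1}` (quasi-polynomial) over the field generated by
the remaining constants, yet generate a number field of super-polynomial degree.  Nothing here
proves VP ≠ VNP or decides wall D.

References: BurgisserClausenShokrollahi1997 ((4.15)–(4.18) autarky); Burgisser2000 (§4.1);
Koiran1997Elimination (elimination of constants, BSS decision setting); AndrewsForbes2022 (Lemma 6.7,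
degree `≤ s^Δ`); LimayeSrinivasanTavenas2021 (§1).
-/

noncomputable section

open MvPolynomial

-- the summit and the problem share the name `ValiantsHypothesis` (D-0017 single-conjunct layout)
set_option linter.dupNamespace false

namespace Summit.ValiantsHypothesis.ValiantsHypothesis.Theorems.SuccinctLiftGenericAdvice

open Literature.Computability.AlgebraicComplexity ArithCircuit

/-! ### Slices of a polynomial in two blocks of variables -/

section Slices

variable {F : Type*} [CommRing F] {σ τ : Type*}

/-- `sumAlgEquiv` on monomials: the monomial `x^{m₁} y^{m₂}` goes to `x^{m₁} · (y^{m₂})`.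
[cite: Burgisser2000, §4.1] -/
theorem sumAlgEquiv_monomial_sumElim (m₁ : σ →₀ ℕ) (m₂ : τ →₀ ℕ) (c : F) :
    sumAlgEquiv F σ τ (monomial (m₁.sumElim m₂) c) = monomial m₁ (monomial m₂ c) := by
  simp [sumAlgEquiv, MvPolynomial.monomial]

omit [CommRing F] in
/-- Exponent vectors on `σ ⊕ τ` are pairs of exponent vectors. [folklore] -/
theorem sumElim_eq_sumElim_iff {u m₁ : σ →₀ ℕ} {v m₂ : τ →₀ ℕ} :
    m₁.sumElim m₂ = u.sumElim v ↔ m₁ = u ∧ m₂ = v := by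
  constructor
  · intro h
    constructor
    · have := congrArg (fun w : σ ⊕ τ →₀ ℕ => w.comapDomain Sum.inl Sum.inl_injective.injOn) h
      simpa using this
    · have := congrArg (fun w : σ ⊕ τ →₀ ℕ => w.comapDomain Sum.inr Sum.inr_injective.injOn) h
      simpa using this
  · rintro ⟨rfl, rfl⟩
    rfl

/-- The `x^u`-slice of `P ∈ F[σ ⊕ τ]` (a polynomial in the `τ`-variables) has as its
`y^v`-coefficient the coefficient of `x^u y^v` in `P`. [folklore] -/
theorem coeff_coeff_sumAlgEquiv (P : MvPolynomial (σ ⊕ τ) F) (u : σ →₀ ℕ) (v : τ →₀ ℕ) :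
    coeff v (coeff u (sumAlgEquiv F σ τ P)) = coeff (u.sumElim v) P := by
  classical
  induction P using MvPolynomial.induction_on' with
  | monomial m c =>
    obtain ⟨m₁, m₂, rfl⟩ : ∃ (m₁ : σ →₀ ℕ) (m₂ : τ →₀ ℕ), m = m₁.sumElim m₂ :=
      ⟨_, _, (Finsupp.comapDomain_sumElim_comapDomain m).symm⟩
    rw [sumAlgEquiv_monomial_sumElim]
    by_cases h₁ : m₁ = u <;> by_cases h₂ : m₂ = v <;>
      simp [coeff_monomial, h₁, h₂, sumElim_eq_sumElim_iff]
  | add p q hp hq => simp only [map_add, coeff_add, hp, hq]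

/-- **Slices do not raise the degree**: every `x^u`-slice of `P` has total degree (in the
`τ`-variables) at most the total degree of `P`. [folklore] -/
theorem totalDegree_coeff_sumAlgEquiv_le (P : MvPolynomial (σ ⊕ τ) F) (u : σ →₀ ℕ) :
    (coeff u (sumAlgEquiv F σ τ P)).totalDegree ≤ P.totalDegree := by
  classical
  refine Finset.sup_le fun v hv => ?_
  rw [mem_support_iff, coeff_coeff_sumAlgEquiv] at hv
  have h := le_totalDegree (mem_support_iff.2 hv)
  rw [Finsupp.sum_sumElim] at h
  exact le_trans (Nat.le_add_left _ _) h

variable {L : Type*} [CommRing L] [Algebra F L]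

/-- Plugging advice `α : τ → L` into the `τ`-variables = evaluating every slice at `α`
(as `F`-algebra maps `F[σ ⊕ τ] → L[σ]`). [cite: BurgisserClausenShokrollahi1997, (4.16)] -/
theorem aeval_sumElim_eq_mapAlgHom_comp (α : τ → L) :
    (aeval (Sum.elim X (C ∘ α) : σ ⊕ τ → MvPolynomial σ L) : MvPolynomial (σ ⊕ τ) F →ₐ[F] _) =
      (mapAlgHom (aeval α)).comp (sumAlgEquiv F σ τ).toAlgHom := by
  refine MvPolynomial.algHom_ext fun i => ?_
  cases i with
  | inl s => simp [mapAlgHom_apply]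
  | inr j => simp [mapAlgHom_apply]

/-- Coefficientwise form of `aeval_sumElim_eq_mapAlgHom_comp`: the `x^u`-coefficient of
`P(x, α)` is the `x^u`-slice of `P` evaluated at `α`. [cite: BurgisserClausenShokrollahi1997, (4.16)] -/
theorem coeff_aeval_sumElim (α : τ → L) (P : MvPolynomial (σ ⊕ τ) F) (u : σ →₀ ℕ) :
    coeff u (aeval (Sum.elim X (C ∘ α) : σ ⊕ τ → MvPolynomial σ L) P) =
      aeval α (coeff u (sumAlgEquiv F σ τ P)) := by
  have := congrArg (fun φ : MvPolynomial (σ ⊕ τ) F →ₐ[F] MvPolynomial σ L => φ P)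
    (aeval_sumElim_eq_mapAlgHom_comp (F := F) (σ := σ) α)
  simp only [AlgHom.comp_apply] at this
  rw [this, mapAlgHom_apply, coeff_map]
  rfl

omit [Algebra F L] [CommRing L] in
/-- Base change as an evaluation: `aeval X f = map (algebraMap F L') f`. [folklore] -/
theorem aeval_X_eq_map {L' : Type*} [CommRing L'] [Algebra F L'] (f : MvPolynomial σ F) :
    aeval (X : σ → MvPolynomial σ L') f = map (algebraMap F L') f := by
  have : (aeval X : MvPolynomial σ F →ₐ[F] MvPolynomial σ L') = mapAlgHom (Algebra.ofId F L') :=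
    MvPolynomial.algHom_ext fun i => by simp [mapAlgHom_apply]
  rw [this, mapAlgHom_apply]
  rfl

end Slices

/-! ### Genericity at scale `δ` -/

section Generic

variable (F : Type*) [CommRing F] {L : Type*} [CommRing L] [Algebra F L] {σ τ : Type*}

/-- **Generic at scale `δ`.** The tuple `α : τ → L` satisfies no non-trivial polynomial relation
over `F` of total degree `≤ δ`.  For a single algebraic `a` over a field this says
`[F(a) : F] > δ` (standard; not needed below); `δ = ∞` is algebraic independence
(`isGenericAt_of_algebraicIndependent`).  The base `F` is an arbitrary commutative ring, so the
notion — and every theorem below — is RELATIVE: advice generic over the ring generated by the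
other constants can be peeled off layer by layer.
[cite: Koiran1997Elimination, §1] -/
def IsGenericAt (α : τ → L) (δ : ℕ) : Prop :=
  ∀ Q : MvPolynomial τ F, Q.totalDegree ≤ δ → aeval α Q = 0 → Q = 0

variable {F}

/-- Genericity is monotone in the scale. [cite: Koiran1997Elimination, §1] -/
theorem IsGenericAt.mono {α : τ → L} {δ δ' : ℕ} (h : IsGenericAt F α δ) (hδ : δ' ≤ δ) :
    IsGenericAt F α δ' :=
  fun Q hQ h0 => h Q (hQ.trans hδ) h0

/-- Algebraically independent advice (in particular a tuple of independent transcendentals) is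
generic at every scale. [cite: BurgisserClausenShokrollahi1997, (4.17)(1)] -/
theorem isGenericAt_of_algebraicIndependent {α : τ → L} (h : AlgebraicIndependent F α) (δ : ℕ) :
    IsGenericAt F α δ :=
  fun Q _ h0 => h (by rw [h0, map_zero])

/-- The empty advice tuple is generic at every scale (over an extension in which `F` embeds).
[cite: BurgisserClausenShokrollahi1997, (4.17)(1)] -/
theorem isGenericAt_of_isEmpty [IsEmpty τ] (hinj : Function.Injective (algebraMap F L))
    (α : τ → L) (δ : ℕ) : IsGenericAt F α δ := by
  intro Q _ h0
  obtain ⟨c, rfl⟩ : ∃ c : F, Q = C c := ⟨coeff 0 Q, (eq_C_of_isEmpty Q)⟩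
  rw [aeval_C] at h0
  have hc : c = 0 := hinj (by rw [h0, map_zero])
  rw [hc, C_0]

/-- **The specialisation lemma.** If `α` is generic at a scale `δ ≥ deg P` and `P(x, α) = f(x)`
with `f ∈ F[σ]`, then `P` does not involve its advice variables: `P = f(x)` in `F[σ ⊕ τ]`
(each `x^u`-slice of `P - f` has degree `≤ δ` and vanishes at `α`).
[cite: BurgisserClausenShokrollahi1997, (4.16)] -/
theorem eq_rename_inl_of_isGenericAt {α : τ → L} {δ : ℕ} (hα : IsGenericAt F α δ)
    (P : MvPolynomial (σ ⊕ τ) F) (hP : P.totalDegree ≤ δ) (f : MvPolynomial σ F)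
    (h : aeval (Sum.elim X (C ∘ α) : σ ⊕ τ → MvPolynomial σ L) P = map (algebraMap F L) f) :
    P = rename Sum.inl f := by
  apply (sumAlgEquiv F σ τ).injective
  have hr : sumAlgEquiv F σ τ (rename Sum.inl f) = map (algebraMap F (MvPolynomial τ F)) f := by
    have := congrArg (fun φ : MvPolynomial σ F →ₐ[F] _ => φ f)
      (sumAlgEquiv_comp_rename_inl (R := F) (S₁ := σ) (S₂ := τ))
    simpa [mapAlgHom_apply] using this
  rw [hr]
  ext u : 1
  rw [coeff_map]
  have hQ : coeff u (sumAlgEquiv F σ τ P) - C (coeff u f) = 0 := by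
    apply hα
    · refine (totalDegree_sub _ _).trans (max_le ?_ ?_)
      · exact (totalDegree_coeff_sumAlgEquiv_le P u).trans hP
      · simp
    · rw [map_sub, ← coeff_aeval_sumElim, h, coeff_map, aeval_C, sub_self]
  rw [sub_eq_zero] at hQ
  rw [hQ]
  rfl

/-- … hence ANY advice `β`, over any `F`-algebra `L'`, gives the same result `f`.
[cite: BurgisserClausenShokrollahi1997, (4.16)] -/
theorem aeval_sumElim_eq_of_isGenericAt {α : τ → L} {δ : ℕ} (hα : IsGenericAt F α δ)
    (P : MvPolynomial (σ ⊕ τ) F) (hP : P.totalDegree ≤ δ) (f : MvPolynomial σ F)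
    (h : aeval (Sum.elim X (C ∘ α) : σ ⊕ τ → MvPolynomial σ L) P = map (algebraMap F L) f)
    {L' : Type*} [CommRing L'] [Algebra F L'] (β : τ → L') :
    aeval (Sum.elim X (C ∘ β) : σ ⊕ τ → MvPolynomial σ L') P = map (algebraMap F L') f := by
  rw [eq_rename_inl_of_isGenericAt hα P hP f h, aeval_rename, Sum.elim_comp_inl, aeval_X_eq_map]

end Generic

/-! ### Circuits: generic advice is free at the identical skeleton -/

section Circuits

variable {F : Type*} [CommRing F] {L : Type*} [CommRing L] [Algebra F L] {σ τ : Type*}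

omit [Algebra F L] in
/-- The substitution underlying "advice `α` for the `τ`-variables". [cite: Burgisser2000, §4.1] -/
theorem substVCFun_advice (α : τ → L) :
    substVCFun (Sum.elim Sum.inl fun j => Sum.inr (α j) : σ ⊕ τ → σ ⊕ L) =
      (Sum.elim X (C ∘ α) : σ ⊕ τ → MvPolynomial σ L) := by
  funext i
  cases i <;> rfl

/-- Semantics of "the skeleton `C₀` run over `L` with advice `α`": it computes `C₀.eval (x, α)`.
[cite: Burgisser2000, §4.1] -/
theorem eval_map_substVC_advice (C₀ : ArithCircuit F (σ ⊕ τ)) (α : τ → L) :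
    ((C₀.map (algebraMap F L)).substVC (Sum.elim Sum.inl fun j => Sum.inr (α j))).eval =
      aeval (Sum.elim X (C ∘ α) : σ ⊕ τ → MvPolynomial σ L) C₀.eval := by
  rw [eval_substVC, eval_map_apply, aeval_map_algebraMap, substVCFun_advice]

omit [Algebra F L] in
/-- Semantics of "the skeleton `C₀` with `L`-rational advice `b`" (an honest circuit over `L`).
[cite: Burgisser2000, §4.1] -/
theorem eval_substVC_advice (C₀ : ArithCircuit L (σ ⊕ τ)) (b : τ → L) :
    (C₀.substVC (Sum.elim Sum.inl fun j => Sum.inr (b j))).eval =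
      aeval (Sum.elim X (C ∘ b) : σ ⊕ τ → MvPolynomial σ L) C₀.eval := by
  rw [eval_substVC, substVCFun_advice]

/-- **No advice**: padding a circuit `P` over `F` with an unused block of advice variables and
running it with any advice `α` computes (the image of) `P.eval`. [cite: Burgisser2000, §4.1] -/
theorem eval_advice_of_noAdvice (P : ArithCircuit F σ) (α : τ → L) :
    (((P.substVC fun x => Sum.inl (Sum.inl x)).map (algebraMap F L)).substVC
        (Sum.elim Sum.inl fun j => Sum.inr (α j))).eval = map (algebraMap F L) P.eval := by
  rw [eval_map_substVC_advice, eval_substVC, comp_aeval_apply]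
  have hX : (fun i : σ => aeval (Sum.elim X (C ∘ α) : σ ⊕ τ → MvPolynomial σ L)
      (substVCFun (fun x : σ => (Sum.inl (Sum.inl x) : (σ ⊕ τ) ⊕ F)) i)) = X := by
    funext i
    simp [substVCFun]
  rw [hX, aeval_X_eq_map]

/-- **Generic advice is not used.** If the skeleton `C₀` (constants in `F`, advice variables `τ`)
run over `L` with advice `α` generic at a scale `δ ≥ deg C₀.eval` computes (the image of)
`f ∈ F[σ]`, then the skeleton computes `f(x)` as a polynomial identity in `F[σ ⊕ τ]`.
[cite: BurgisserClausenShokrollahi1997, (4.16)] -/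
theorem eval_eq_rename_of_isGenericAt {C₀ : ArithCircuit F (σ ⊕ τ)} {α : τ → L} {δ : ℕ}
    (hα : IsGenericAt F α δ) (hδ : C₀.eval.totalDegree ≤ δ) {f : MvPolynomial σ F}
    (h : ((C₀.map (algebraMap F L)).substVC (Sum.elim Sum.inl fun j => Sum.inr (α j))).Computes
      (map (algebraMap F L) f)) :
    C₀.eval = rename Sum.inl f :=
  eq_rename_inl_of_isGenericAt hα C₀.eval hδ f (by rw [← eval_map_substVC_advice]; exact h)

/-- **Graded autarky at the identical skeleton, `F`-rational form.** Under the hypotheses of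
`eval_eq_rename_of_isGenericAt`, replacing the generic advice `α` by ANY `F`-rational values `b`
gives a circuit over `F` computing `f` — with the same gates, the same wire count and the same
product-depth (`edgeSize_substVC`, `productDepth_substVC`).
[cite: BurgisserClausenShokrollahi1997, (4.17)(1)] -/
theorem computes_substVC_of_isGenericAt {C₀ : ArithCircuit F (σ ⊕ τ)} {α : τ → L} {δ : ℕ}
    (hα : IsGenericAt F α δ) (hδ : C₀.eval.totalDegree ≤ δ) {f : MvPolynomial σ F}
    (h : ((C₀.map (algebraMap F L)).substVC (Sum.elim Sum.inl fun j => Sum.inr (α j))).Computes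
      (map (algebraMap F L) f)) (b : τ → F) :
    (C₀.substVC (Sum.elim Sum.inl fun j => Sum.inr (b j))).Computes f := by
  unfold ArithCircuit.Computes
  rw [eval_substVC_advice, eval_eq_rename_of_isGenericAt hα hδ h, aeval_rename, Sum.elim_comp_inl,
    aeval_X_left_apply]

/-- **Graded autarky at the identical skeleton, general form.** Under the same hypotheses, ANY
advice `β` in ANY `F`-algebra `L'` computes (the image of) `f`.
[cite: BurgisserClausenShokrollahi1997, (4.17)(1)] -/
theorem computes_advice_of_isGenericAt {C₀ : ArithCircuit F (σ ⊕ τ)} {α : τ → L} {δ : ℕ}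
    (hα : IsGenericAt F α δ) (hδ : C₀.eval.totalDegree ≤ δ) {f : MvPolynomial σ F}
    (h : ((C₀.map (algebraMap F L)).substVC (Sum.elim Sum.inl fun j => Sum.inr (α j))).Computes
      (map (algebraMap F L) f)) {L' : Type*} [CommRing L'] [Algebra F L'] (β : τ → L') :
    ((C₀.map (algebraMap F L')).substVC (Sum.elim Sum.inl fun j => Sum.inr (β j))).Computes
      (map (algebraMap F L') f) := by
  unfold ArithCircuit.Computes
  rw [eval_map_substVC_advice, eval_eq_rename_of_isGenericAt hα hδ h, aeval_rename,
    Sum.elim_comp_inl, aeval_X_eq_map]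

omit [CommRing F] in
/-- `1 ≤ n^c + c` (the wire budgets of the dial are positive). [folklore] -/
theorem one_le_pow_add (n c : ℕ) : 1 ≤ n ^ c + c := by
  rcases Nat.eq_zero_or_pos c with rfl | hc
  · simp
  · exact le_add_left hc

/-- **The scale `s^Δ` suffices**: a skeleton with `≤ s` wires and product-depth `≤ Δ` computes a
polynomial of degree `≤ s^Δ` (Andrews–Forbes), so advice generic at scale `s^Δ` is free.
[cite: AndrewsForbes2022, Lemma 6.7 (proof)] -/
theorem computes_substVC_of_isGenericAt_pow {C₀ : ArithCircuit F (σ ⊕ τ)} {α : τ → L} {s Δ : ℕ}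
    (h1 : 1 ≤ s) (hs : C₀.edgeSize ≤ s) (hΔ : C₀.productDepth ≤ Δ)
    (hα : IsGenericAt F α (s ^ Δ)) {f : MvPolynomial σ F}
    (h : ((C₀.map (algebraMap F L)).substVC (Sum.elim Sum.inl fun j => Sum.inr (α j))).Computes
      (map (algebraMap F L) f)) (b : τ → F) :
    (C₀.substVC (Sum.elim Sum.inl fun j => Sum.inr (b j))).Computes f :=
  computes_substVC_of_isGenericAt hα (C₀.totalDegree_eval_le_edgeSize_pow h1 hs hΔ) h b

/-- **Algebraically independent advice is free** (division-free autarky of purely transcendental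
extensions, at the identical skeleton). [cite: BurgisserClausenShokrollahi1997, (4.17)(1)] -/
theorem computes_substVC_of_algebraicIndependent {C₀ : ArithCircuit F (σ ⊕ τ)} {α : τ → L}
    (hα : AlgebraicIndependent F α) {f : MvPolynomial σ F}
    (h : ((C₀.map (algebraMap F L)).substVC (Sum.elim Sum.inl fun j => Sum.inr (α j))).Computes
      (map (algebraMap F L) f)) (b : τ → F) :
    (C₀.substVC (Sum.elim Sum.inl fun j => Sum.inr (b j))).Computes f :=
  computes_substVC_of_isGenericAt (isGenericAt_of_algebraicIndependent hα _) le_rfl h b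

end Circuits

/-! ### The dial for the permanent: generic advice over `ℂ` = the `ℚ`-level -/

section Dial

open Summit.ValiantsHypothesis.ValiantsHypothesis.Theorems.SuccinctLift
open Summit.ValiantsHypothesis.ValiantsHypothesis.Theorems.SuccinctLiftNumberFieldDescent

/-- Dial point `D_gen`: per has `n^c+c`-wire, depth-`Δ(n)` circuits over `ℂ` all of whose
non-rational constants `α_n : Fin t_n → ℂ` form a tuple generic over `ℚ` at scale
`(n^c+c)^{Δ(n)}` (e.g. algebraically independent transcendentals, or algebraic numbers of huge
degree in general position). [cite: BurgisserClausenShokrollahi1997, (4.15)] -/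
def PerEasyGeneric (Δ : ℕ → ℕ) : Prop :=
  ∃ c : ℕ, ∀ n : ℕ, ∃ (t : ℕ) (α : Fin t → ℂ) (C₀ : ArithCircuit ℚ ((Fin n × Fin n) ⊕ Fin t)),
    IsGenericAt ℚ α ((n ^ c + c) ^ Δ n) ∧
    ((C₀.map (algebraMap ℚ ℂ)).substVC (Sum.elim Sum.inl fun j => Sum.inr (α j))).Computes
      (perPoly (Fin n) ℂ) ∧ C₀.productDepth ≤ Δ n ∧ C₀.edgeSize ≤ n ^ c + c

/-- **The dial collapses above the genericity scale** (every depth profile `Δ`): poly-wire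
depth-`Δ` circuits for per with generic advice exist iff they exist over `ℚ` — with the identical
skeleton (`⇒`: specialise the advice to `0`; `⇐`: no advice). Combined with gen 29
(`perEasyNF_iff_perEasyRat`): on the constants dial of wall D only tuples that are algebraically
dependent at scale `(n^c+c)^{Δ(n)}` yet generate fields of super-polynomial degree remain.
[cite: BurgisserClausenShokrollahi1997, (4.17)] -/
theorem perEasyGeneric_iff_perEasyRat (Δ : ℕ → ℕ) : PerEasyGeneric Δ ↔ PerEasyRat Δ := by
  constructor
  · rintro ⟨c, h⟩
    refine ⟨c, fun n => ?_⟩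
    obtain ⟨t, α, C₀, hα, hper, hd, hw⟩ := h n
    refine ⟨C₀.substVC (Sum.elim Sum.inl fun _ => Sum.inr 0), ?_, ?_, ?_⟩
    · refine computes_substVC_of_isGenericAt_pow (one_le_pow_add n c) hw hd hα ?_ fun _ => 0
      rwa [map_perPoly]
    · rwa [productDepth_substVC]
    · rwa [edgeSize_substVC]
  · rintro ⟨c, h⟩
    refine ⟨c, fun n => ?_⟩
    obtain ⟨C, hper, hd, hw⟩ := h n
    refine ⟨0, Fin.elim0, C.substVC fun x => Sum.inl (Sum.inl x),
      isGenericAt_of_isEmpty (algebraMap ℚ ℂ).injective _ _, ?_, ?_, ?_⟩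
    · unfold ArithCircuit.Computes at hper ⊢
      rw [eval_advice_of_noAdvice, hper, map_perPoly]
    · simpa only [productDepth_substVC, productDepth_mapCoeff] using hd
    · simpa only [edgeSize_substVC, edgeSize_mapCoeff] using hw

/-- **The two ends of the constants dial meet at `ℚ`**: generic advice (this file) and number
fields of polynomial degree (gen 29, `perEasyNF_iff_perEasyRat`) are the same dial point.
[cite: BurgisserClausenShokrollahi1997, (4.15) and (4.17)] -/
theorem perEasyGeneric_iff_perEasyNF (Δ : ℕ → ℕ) : PerEasyGeneric Δ ↔ PerEasyNF Δ :=
  (perEasyGeneric_iff_perEasyRat Δ).trans (perEasyNF_iff_perEasyRat Δ).symm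

/-- Hardness form for wall D's dial: per is hard for generic-advice poly-wire depth-`Δ` circuits
iff it is hard over `ℚ`. [cite: BurgisserClausenShokrollahi1997, (4.17)] -/
theorem perHardGeneric_iff_perHardRat (Δ : ℕ → ℕ) : ¬ PerEasyGeneric Δ ↔ ¬ PerEasyRat Δ :=
  not_congr (perEasyGeneric_iff_perEasyRat Δ)

end Dial

end Summit.ValiantsHypothesis.ValiantsHypothesis.Theorems.SuccinctLiftGenericAdvice
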